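import Literature.MathematicalPhysics.QuantumFieldTheory.Balaban1983to89.B10Eq2HaarCompatibility
import Summits.QuantumFields.YangMills.Theorems.BalabanUVNodesN09OneDefectAveraging

/-!
# BalabanUVNodes ∕ N08 — THE GUARD DECOMPOSITION OF THE TYPED (0.4) AVERAGING: under product Haar `dU` the typed block averaging
# `BlockAveraging.avgFun ℰ` IS the axial (straight-line) averaging OFF its small-field guard, so the TYPED E6′ letter `Ū_*(dU) = dV` is a
# statement about the guard event alone, holds UP TO TOTAL VARIATION `dU(guard)`, and `dU(guard) ≤ #bonds · Haar{dist1 < δ}`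

WIDTH SEAT `pub-ymgap-dag-n08-w3` g2 (HUMAN RULING D-0149 work-bound push; plan `W-SEAT-START-LIST.md` v7 §n08 item 3, PART 6 = a located piece
inside the item's residue «E6′ proper»), 2026-08-28.  Track A, DAG node N08 = [Balaban1985UV3] Thm 1 p. 257 (compact) + Thm 2 p. 272; key item K1⁷
`StabilityBAtRecordR13SepCoPH` (stmt-QuantumFields-20542), `--supports … --as helper`.  COUNT-NEUTRAL.  Parts 1–5 (g0: p583667 `…Inhabited`, p585871
`…OneBond`, p588078 `…PrivateSources`, p589866 `…Forests`, p590060 `…InvariantObservables`) are consequences of COARSE-GAUGE INVARIANCE of the image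
law alone; this part is the first to use the STRUCTURE of the typed averaging.

THE TYPED OBJECT.  In the standing range `j + 1 ≤ m + K` the slot's averaging of record is `(avOfPrint N S j).avg = BlockAveraging.avgFun expMeanLogSU`
([Balaban1987RG1] (0.4) p. 253 typed as a TOTAL map, `Lit/…/BlockAveraging` §3): `Ū(c) = corr(U,c) · U(c)`, `U(c)` the straight-line transporter
`AveragingRT.axialAvg`, `corr = ℰ.avg (loop variables)` ON the small-field guard `Small ℰ U c` (every loop variable `U(Γ ∪ [x,x′] ∪ (−Γ′) ∪ (−c))` within `δ`
of `1` — the domain of the printed `log`), `corr = 1` OFF it (`BlockAveragingHaarAC.avgFun_of_not_small`); `axial_*(dU) = dV` EXACTLY (`AveragingRT.map_axialAvg`).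

WHAT THIS FILE PROVES ([folklore] measure theory over landed modules; nothing of Bałaban's asserted).  §1 (ANY group, ANY small-loop average `ℰ`, standing
range): off the GUARD EVENT `{U | ∃ c, Small ℰ U c}` the typed averaging is the axial one; the image laws of `dU` restricted OFF the guard under `Ū` and under
the axial averaging coincide (`map_restrict_compl_guard_avgFun_eq`); for every measurable `A`, **`|Ū_*(dU)(A) − dV(A)| ≤ dU(guard)`** (`map_avgFun_apply_le`,
`le_map_avgFun_apply_add`, `abs_map_avgFun_real_sub_le`); and EXACTLY: **`Ū_*(dU) = dV ⟺ (dU↾guard)∘Ū⁻¹ = (dU↾guard)∘axial⁻¹`**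
(`map_avgFun_eq_iff_restrict_guard`) — the typed E6′ letter is a statement about the guard event alone.  §2: for EVERY version `T` of
[Balaban1985Averaging] (10) along `blockAvg ℰ`, `|∫_A T1 dV − dV(A)| ≤ dU(guard)` (`abs_setIntegral_T_one_sub_le`).  §3 (`d ≥ 2`): at a NON-CENTRAL index
(n09's `exists_not_isCentral`) the loop variable conjugated by the half-line transporter `pre` is `A(U) · U(β(c))⁻¹` with `A` free of the central crossing
bond `β(c)` (`BlockAveragingHaarAC`'s normal form), the `dU`-preserving shear `U(β(c)) ↦ k·U(β(c))` right-translates it, so ITS LAW IS EXACTLY HAAR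
(`map_conjLoopHol_eq_haar`, Weil uniqueness); hence **`dU{Small ℰ · c} ≤ Haar{dist1 < δ}`** (`measure_small_le_haar_ball`) and
`dU(guard) ≤ #PBond(j+1) · Haar{dist1 < δ}` (`measure_guard_le`).  §4: all of it at the [B10] slot's `avOfPrint N S j` on `SU(N)`, every `N`, in range
(beyond it the defect is `0`, p434996): `|(avOfPrint)_*(dU)(A) − dV(A)| ≤ dU(guard) ≤ #PBond · Haar_{SU(N)}{‖W − 1‖ < min(1∕3, π∕N)}`, the iff, and
the same for `∫_A (𝔗 S j).T 1 dV` ∕ `(𝔗 S j).T 1 =ᵐ 1` for EVERY transformation family `𝔗 : Node00.TFamily₃ N L`; and `0 < dU(guard)` (`measure_guard_pos`).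

HONEST SEAM (located; nothing ruled here).  (i) The typed E6′ letter can fail ONLY on the guard event, which is `dU`-RARE (product-Haar fields are rough:
ALL `(d!)²·L^d` loop variables of a bond within `δ ≤ 1∕3` of `1`), and this file bounds the defect; the typed E6′ is NOT decided here (neither proved nor
refuted).  (ii) pub-balaban3d DEPMAP v6 §16.5 (c2) ∕ §16.6 (job j147293) measured a `≈ 10⁻³` E6′ violation on a side-2 image torus for the UNGUARDED
principal-log averaging (print's (15) read a.e.); those numerics do NOT transfer to the typed letter `(avgFun expMeanLogSU)_*(dU) = dV`, whose defect is
`≤ dU(guard)`; whether the typed TOTAL EXTENSION (value `U(c)` off the guard, cell row T4-D.L) is the intended reading of (15) on rough fields is the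
planners' ∕ pub-balaban's call.  (iii) Count-neutral; N08 NOT discharged; counts unmoved (typed 28∕28 · discharged 5∕27); one finite 𝕋⁴ programme at
fixed ε — R4 closes the CONDITIONAL rung `BalabanLadder.UV` only; the Yang–Mills mass gap (Clay) is NOT proved by any of this; nothing continuum ∕ ℝ³ ∕ ℝ⁴
∕ OS ∕ mass gap.  0 `sorry`, 0 `def`, 0 `instance`, standard axioms.
-/

noncomputable section

open MeasureTheory

namespace Summit.QuantumFields.YangMills.BalabanUVNodes.N08HaarCompatibilityGuard

open Literature.MathematicalPhysics.QuantumFieldTheory.Balaban1983to89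
open Literature.MathematicalPhysics.QuantumFieldTheory.Balaban1983to89.AveragingRT
  (axialAvg map_axialAvg measurable_axialAvg measurePreserving_mulLeft measure_eq_mass_smul_of_invariant)
open Literature.MathematicalPhysics.QuantumFieldTheory.Balaban1983to89.BlockAveraging
  (Idx off loopHol Small corr avgFun blockAvg blockAvg_avg measurableSet_small measurable_loopHol measurable_avgFun)
open Literature.MathematicalPhysics.QuantumFieldTheory.Balaban1983to89.BlockAveragingHaarAC
  (centralBond openHol IsCentral pre post loopHol_eq_openHol_mul axialAvg_eq_pre_mul_mul_post pre_update post_update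
    openHol_update_of_not_isCentral avgFun_of_not_small)
open Summit.QuantumFields.YangMills.BalabanUVNodes.N09OneDefectAveraging (exists_not_isCentral)

/-! ## §1. Off the guard the typed averaging is the axial one; the typed E6′ letter lives on the guard -/

section Generic

variable {P : Params} {j : ℕ} {G : Type*} [GaugeGroup G] (ℰ : LoopAverage G)

/-- **OFF THE GUARD EVENT `{U | ∃ c, Small ℰ U c}` THE TYPED (0.4) AVERAGING IS THE AXIAL AVERAGING**: if no coarse bond is in its small-field domain,
`Ū(U) = U(·)` (the straight-line transporters). [cite: Balaban1987RG1, (0.4) p.253 (the typed total extension; bookkeeping)] -/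
theorem avgFun_eq_axialAvg_of_not_mem_guard {U : GaugeField P j G} (hU : U ∉ {U : GaugeField P j G | ∃ c : PBond P (j + 1), Small ℰ U c}) :
    avgFun ℰ U = axialAvg U :=
  funext fun c => avgFun_of_not_small ℰ U c fun hc => hU ⟨c, hc⟩

/-- **PREIMAGES UNDER `Ū` AND UNDER THE AXIAL AVERAGING DIFFER ONLY INSIDE THE GUARD**: `Ū⁻¹ A ⊆ axial⁻¹ A ∪ guard`. [folklore] -/
theorem preimage_avgFun_subset (A : Set (GaugeField P (j + 1) G)) :
    avgFun ℰ ⁻¹' A ⊆ axialAvg ⁻¹' A ∪ {U : GaugeField P j G | ∃ c : PBond P (j + 1), Small ℰ U c} := fun U hU => by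
  by_cases hG : U ∈ {U : GaugeField P j G | ∃ c : PBond P (j + 1), Small ℰ U c}
  exacts [Or.inr hG, Or.inl (show axialAvg U ∈ A by rwa [← avgFun_eq_axialAvg_of_not_mem_guard ℰ hG])]

/-- … and `axial⁻¹ A ⊆ Ū⁻¹ A ∪ guard`. [folklore] -/
theorem preimage_axialAvg_subset (A : Set (GaugeField P (j + 1) G)) : (axialAvg : GaugeField P j G → GaugeField P (j + 1) G) ⁻¹' A ⊆
      avgFun ℰ ⁻¹' A ∪ {U : GaugeField P j G | ∃ c : PBond P (j + 1), Small ℰ U c} := fun U hU => by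
  by_cases hG : U ∈ {U : GaugeField P j G | ∃ c : PBond P (j + 1), Small ℰ U c}
  exacts [Or.inr hG, Or.inl (show avgFun ℰ U ∈ A by rwa [avgFun_eq_axialAvg_of_not_mem_guard ℰ hG])]

variable [MeasurableSpace G] [RegularGaugeGroup G]

/-- **THE GUARD EVENT IS MEASURABLE** (a finite union of the measurable small-field domains). [folklore] -/
theorem measurableSet_guard : MeasurableSet {U : GaugeField P j G | ∃ c : PBond P (j + 1), Small ℰ U c} := by
  rw [Set.setOf_exists]
  exact MeasurableSet.iUnion fun c => measurableSet_small ℰ c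

variable [HaarData G]

/-- **`Ū_*(dU)(A) ≤ dV(A) + dU(guard)`** for every measurable `A`, every measurable small-loop average, in the standing range (where
`axial_*(dU) = dV`, `AveragingRT.map_axialAvg`). [cite: Balaban1987RG1, (0.4) p.253 (bookkeeping; E6′ itself NOT IN PRINT)] -/
theorem map_avgFun_apply_le (hj : j + 1 ≤ P.m + P.K) (hE : ∀ n, Measurable fun W : Fin (n + 1) → G => ℰ.E W)
    {A : Set (GaugeField P (j + 1) G)} (hA : MeasurableSet A) :
    (fieldMeasure P j G).map (avgFun ℰ) A ≤
      fieldMeasure P (j + 1) G A + fieldMeasure P j G {U : GaugeField P j G | ∃ c : PBond P (j + 1), Small ℰ U c} := by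
  rw [Measure.map_apply (measurable_avgFun ℰ hE) hA, ← map_axialAvg (G := G) hj, Measure.map_apply measurable_axialAvg hA]
  exact (measure_mono (preimage_avgFun_subset ℰ A)).trans (measure_union_le _ _)

/-- **`dV(A) ≤ Ū_*(dU)(A) + dU(guard)`** for every measurable `A` (standing range). [cite: Balaban1987RG1, (0.4) p.253 (bookkeeping; E6′ NOT IN PRINT)] -/
theorem le_map_avgFun_apply_add (hj : j + 1 ≤ P.m + P.K) (hE : ∀ n, Measurable fun W : Fin (n + 1) → G => ℰ.E W)
    {A : Set (GaugeField P (j + 1) G)} (hA : MeasurableSet A) :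
    fieldMeasure P (j + 1) G A ≤
      (fieldMeasure P j G).map (avgFun ℰ) A + fieldMeasure P j G {U : GaugeField P j G | ∃ c : PBond P (j + 1), Small ℰ U c} := by
  rw [Measure.map_apply (measurable_avgFun ℰ hE) hA, ← map_axialAvg (G := G) hj, Measure.map_apply measurable_axialAvg hA]
  exact (measure_mono (preimage_axialAvg_subset ℰ A)).trans (measure_union_le _ _)

/-- Two-sided sandwich ⇒ absolute-value bound, for finite quantities (plumbing). [folklore] -/
private theorem abs_toReal_sub_toReal_le {a b e : ENNReal} (ha : a ≠ ⊤) (hb : b ≠ ⊤) (he : e ≠ ⊤) (h₁ : a ≤ b + e) (h₂ : b ≤ a + e) :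
    |a.toReal - b.toReal| ≤ e.toReal := by
  have h₁' := ENNReal.toReal_mono (ENNReal.add_ne_top.2 ⟨hb, he⟩) h₁
  have h₂' := ENNReal.toReal_mono (ENNReal.add_ne_top.2 ⟨ha, he⟩) h₂
  rw [ENNReal.toReal_add hb he] at h₁'
  rw [ENNReal.toReal_add ha he] at h₂'
  exact abs_sub_le_iff.2 ⟨by linarith, by linarith⟩

/-- **THE TYPED E6′ LETTER HOLDS UP TO TOTAL VARIATION `dU(guard)`**: `|Ū_*(dU)(A) − dV(A)| ≤ dU(guard)` for every measurable `A`, every measurable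
small-loop average `ℰ`, in the standing range. [cite: Balaban1987RG1, (0.4) p.253 (bookkeeping; E6′ itself NOT IN PRINT)] -/
theorem abs_map_avgFun_real_sub_le (hj : j + 1 ≤ P.m + P.K) (hE : ∀ n, Measurable fun W : Fin (n + 1) → G => ℰ.E W)
    {A : Set (GaugeField P (j + 1) G)} (hA : MeasurableSet A) :
    |((fieldMeasure P j G).map (avgFun ℰ)).real A - (fieldMeasure P (j + 1) G).real A| ≤
      (fieldMeasure P j G).real {U : GaugeField P j G | ∃ c : PBond P (j + 1), Small ℰ U c} := by
  haveI : IsProbabilityMeasure ((fieldMeasure P j G).map (avgFun ℰ)) :=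
    Measure.isProbabilityMeasure_map (measurable_avgFun ℰ hE).aemeasurable
  exact abs_toReal_sub_toReal_le (measure_ne_top _ _) (measure_ne_top _ _) (measure_ne_top _ _)
    (map_avgFun_apply_le ℰ hj hE hA) (le_map_avgFun_apply_add ℰ hj hE hA)

/-- **RESTRICTED OFF THE GUARD, THE IMAGE LAWS OF `dU` UNDER `Ū` AND UNDER THE AXIAL AVERAGING COINCIDE** (the two maps agree there pointwise).
[cite: Balaban1987RG1, (0.4) p.253 (bookkeeping)] -/
theorem map_restrict_compl_guard_avgFun_eq :
    ((fieldMeasure P j G).restrict {U : GaugeField P j G | ∃ c : PBond P (j + 1), Small ℰ U c}ᶜ).map (avgFun ℰ) =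
      ((fieldMeasure P j G).restrict {U : GaugeField P j G | ∃ c : PBond P (j + 1), Small ℰ U c}ᶜ).map axialAvg := by
  refine Measure.map_congr ?_
  filter_upwards [ae_restrict_mem (measurableSet_guard ℰ).compl] with U hU
  exact avgFun_eq_axialAvg_of_not_mem_guard ℰ hU

/-- The image law splits along the guard: `dU∘f⁻¹ = (dU↾guard)∘f⁻¹ + (dU↾guardᶜ)∘f⁻¹` (plumbing). [folklore] -/
theorem map_eq_restrict_guard_add {f : GaugeField P j G → GaugeField P (j + 1) G} (hf : Measurable f) :
    (fieldMeasure P j G).map f =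
      ((fieldMeasure P j G).restrict {U : GaugeField P j G | ∃ c : PBond P (j + 1), Small ℰ U c}).map f +
        ((fieldMeasure P j G).restrict {U : GaugeField P j G | ∃ c : PBond P (j + 1), Small ℰ U c}ᶜ).map f := by
  rw [← Measure.map_add _ _ hf, Measure.restrict_add_restrict_compl (measurableSet_guard ℰ)]

/-- **THE TYPED E6′ LETTER IS A STATEMENT ABOUT THE GUARD EVENT ALONE**: `Ū_*(dU) = dV ⟺ (dU↾guard)∘Ū⁻¹ = (dU↾guard)∘axial⁻¹` — exact Haar
compatibility of the typed (0.4) averaging holds IF AND ONLY IF, restricted to its small-field guard, the correction factor does not change the image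
law of the axial averaging (standing range; off the guard the two maps agree, and `axial_*(dU) = dV`).
[cite: Balaban1987RG1, (0.4) p.253 (bookkeeping; E6′ itself NOT IN PRINT)] -/
theorem map_avgFun_eq_iff_restrict_guard (hj : j + 1 ≤ P.m + P.K) (hE : ∀ n, Measurable fun W : Fin (n + 1) → G => ℰ.E W) :
    (fieldMeasure P j G).map (avgFun ℰ) = fieldMeasure P (j + 1) G ↔
      ((fieldMeasure P j G).restrict {U : GaugeField P j G | ∃ c : PBond P (j + 1), Small ℰ U c}).map (avgFun ℰ) =
        ((fieldMeasure P j G).restrict {U : GaugeField P j G | ∃ c : PBond P (j + 1), Small ℰ U c}).map axialAvg := by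
  rw [← map_axialAvg (G := G) hj, map_eq_restrict_guard_add ℰ (measurable_avgFun ℰ hE), map_eq_restrict_guard_add ℰ measurable_axialAvg,
    map_restrict_compl_guard_avgFun_eq ℰ]
  refine ⟨fun h => ?_, fun h => by rw [h]⟩
  ext A hA
  have hAeq := congrArg (fun ν : Measure (GaugeField P (j + 1) G) => ν A) h
  simp only [Measure.add_apply] at hAeq
  exact (ENNReal.add_left_inj (measure_ne_top _ _)).1 hAeq

/-! ## §2. The T-letters: every version's `∫_A T1 dV` is within `dU(guard)` of `dV(A)` -/

/-- **`|∫_A T1 dV − dV(A)| ≤ dU(guard)`** for EVERY version `T` of (10) along the typed block averaging `blockAvg ℰ` and every measurable `A`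
(standing range; `∫_A T1 dV = dU(Ū⁻¹ A)` by p434996 `setIntegral_T_one`).
[cite: Balaban1985Averaging, (10) p.19; Balaban1987RG1, (0.4) p.253 (bookkeeping; «T1 = 1» NOT IN PRINT)] -/
theorem abs_setIntegral_T_one_sub_le (hj : j + 1 ≤ P.m + P.K) (hE : ∀ n, Measurable fun W : Fin (n + 1) → G => ℰ.E W)
    (T : RTOpI P j G (blockAvg ℰ)) {A : Set (GaugeField P (j + 1) G)} (hA : MeasurableSet A) :
    |∫ V in A, T.T 1 V ∂(fieldMeasure P (j + 1) G) - (fieldMeasure P (j + 1) G).real A| ≤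
      (fieldMeasure P j G).real {U : GaugeField P j G | ∃ c : PBond P (j + 1), Small ℰ U c} := by
  have havg : Measurable (blockAvg (P := P) (j := j) ℰ).avg := by rw [blockAvg_avg]; exact measurable_avgFun ℰ hE
  rw [B10Eq2HaarCompatibility.setIntegral_T_one T havg hA, blockAvg_avg, ← Measure.map_apply (measurable_avgFun ℰ hE) hA]
  exact abs_map_avgFun_real_sub_le ℰ hj hE hA

end Generic

/-! ## §3. The size of the guard: one non-central loop variable is exactly Haar distributed -/

section GuardSize

variable {P : Params} {j : ℕ} {G : Type*} [GaugeGroup G] (ℰ : LoopAverage G)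

/-- THE CONJUGATED LOOP VARIABLE IN NORMAL FORM: `pre⁻¹ · U(loop_i) · pre = (pre⁻¹ · V_i · post⁻¹) · U(β(c))⁻¹` (`V_i` the open holonomy, `β(c)` the
central crossing bond; `BlockAveragingHaarAC`'s `loopHol = openHol · U(c)⁻¹`, `U(c) = pre · U(β(c)) · post`). [folklore] -/
theorem conj_loopHol_eq (U : GaugeField P j G) (c : PBond P (j + 1)) (i : Idx P) :
    (pre U c)⁻¹ * loopHol U c i * pre U c = (pre U c)⁻¹ * openHol U c i * (post U c)⁻¹ * (U (centralBond c))⁻¹ := by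
  rw [loopHol_eq_openHol_mul, axialAvg_eq_pre_mul_mul_post]
  group

/-- THE SHEAR AT THE CENTRAL CROSSING BOND: left-multiplying the coordinate `U(β(c))` by `k` is the update `U[β(c) ↦ k · U(β(c))]`. [folklore] -/
theorem mulLeft_update_one_eq [DecidableEq (PBond P j)] (c : PBond P (j + 1)) (k : G) (U : GaugeField P j G) :
    (fun b => Function.update (fun _ : PBond P j => (1 : G)) (centralBond c) k b * U b) =
      Function.update U (centralBond c) (k * U (centralBond c)) := by
  funext b
  by_cases hb : b = centralBond c
  · subst hb
    rw [Function.update_self, Function.update_self]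
  · rw [Function.update_of_ne hb, Function.update_of_ne hb, one_mul]

/-- **THE SHEAR RIGHT-TRANSLATES THE CONJUGATED NON-CENTRAL LOOP VARIABLE**: at `U[β(c) ↦ k · U(β(c))]` it becomes `(…) · k⁻¹` (the open holonomy of a
non-central index, `pre` and `post` do not see `U(β(c))`). [folklore] -/
theorem conj_loopHol_update [DecidableEq (PBond P j)] (hj : j + 1 ≤ P.m + P.K) (U : GaugeField P j G) (c : PBond P (j + 1))
    {i : Idx P} (hi : ¬ IsCentral c i) (k : G) :
    (pre (Function.update U (centralBond c) (k * U (centralBond c))) c)⁻¹ *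
        loopHol (Function.update U (centralBond c) (k * U (centralBond c))) c i *
          pre (Function.update U (centralBond c) (k * U (centralBond c))) c =
      (pre U c)⁻¹ * loopHol U c i * pre U c * k⁻¹ := by
  rw [conj_loopHol_eq, conj_loopHol_eq, pre_update hj, post_update hj, openHol_update_of_not_isCentral hj U c i hi,
    Function.update_self, mul_inv_rev, ← mul_assoc]

variable [MeasurableSpace G] [RegularGaugeGroup G]

/-- The conjugated loop variable is a measurable function of the fine field (plumbing). [folklore] -/
theorem measurable_conj_loopHol (c : PBond P (j + 1)) (i : Idx P) :
    Measurable fun U : GaugeField P j G => (pre U c)⁻¹ * loopHol U c i * pre U c := by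
  have hpre : Measurable fun U : GaugeField P j G => pre U c := T4Continuum.measurable_holAt _
  have hloop : Measurable fun U : GaugeField P j G => loopHol U c i := (measurable_pi_apply i).comp (measurable_loopHol c)
  exact (hpre.inv.mul hloop).mul hpre

variable [HaarData G]

/-- **ONE NON-CENTRAL LOOP VARIABLE OF (0.4), CONJUGATED BY `pre`, IS EXACTLY HAAR DISTRIBUTED UNDER `dU`** (standing range): its law is a probability
measure invariant under every right translation (the shear at `β(c)` preserves `dU`, `AveragingRT.measurePreserving_mulLeft`); Weil uniqueness. [folklore] -/
theorem map_conjLoopHol_eq_haar (hj : j + 1 ≤ P.m + P.K) (c : PBond P (j + 1)) {i : Idx P} (hi : ¬ IsCentral c i) :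
    (fieldMeasure P j G).map (fun U : GaugeField P j G => (pre U c)⁻¹ * loopHol U c i * pre U c) = HaarData.haar := by
  classical
  set Z : GaugeField P j G → G := fun U => (pre U c)⁻¹ * loopHol U c i * pre U c with hZ
  have hZm : Measurable Z := measurable_conj_loopHol c i
  haveI : IsProbabilityMeasure ((fieldMeasure P j G).map Z) := Measure.isProbabilityMeasure_map hZm.aemeasurable
  have hinv : ∀ g : G, ((fieldMeasure P j G).map Z).map (fun x => x * g) = (fieldMeasure P j G).map Z := by
    intro g
    set Φ : GaugeField P j G → GaugeField P j G :=
      fun U b => Function.update (fun _ : PBond P j => (1 : G)) (centralBond c) g⁻¹ b * U b with hΦ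
    have hΦ' : MeasurePreserving Φ (fieldMeasure P j G) (fieldMeasure P j G) := measurePreserving_mulLeft _
    have hcomp : (fun x => x * g) ∘ Z = Z ∘ Φ := by
      funext U
      simp only [Function.comp_apply, hZ, hΦ]
      rw [mulLeft_update_one_eq c g⁻¹ U, conj_loopHol_update hj U c hi g⁻¹, inv_inv]
    rw [Measure.map_map (measurable_mul_const g) hZm, hcomp, ← Measure.map_map hZm hΦ'.measurable, hΦ'.map_eq]
  have h := measure_eq_mass_smul_of_invariant (HaarData.haar : Measure G) ((fieldMeasure P j G).map Z) HaarData.map_mul_left hinv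
  rw [measure_univ, one_smul] at h
  exact h

/-- **`dU{Small ℰ · c} ≤ Haar{g | dist1 g < δ}`** at every coarse bond (`d ≥ 2`, standing range): the small-field domain asks in particular ONE non-central
loop variable within `δ` of `1`; `dist1` is conjugation invariant and that variable, conjugated, is Haar distributed. [cite: Balaban1987RG1, (0.4) p.253 (bookkeeping)] -/
theorem measure_small_le_haar_ball (hj : j + 1 ≤ P.m + P.K) (hd : 2 ≤ P.d) (c : PBond P (j + 1)) :
    fieldMeasure P j G {U : GaugeField P j G | Small ℰ U c} ≤ HaarData.haar {g : G | dist1 g < ℰ.δ} := by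
  obtain ⟨i, hi⟩ := exists_not_isCentral hd c
  have hball : MeasurableSet {g : G | dist1 g < ℰ.δ} := measurableSet_lt RegularGaugeGroup.measurable_dist1 measurable_const
  have hsub : {U : GaugeField P j G | Small ℰ U c} ⊆
      (fun U : GaugeField P j G => (pre U c)⁻¹ * loopHol U c i * pre U c) ⁻¹' {g : G | dist1 g < ℰ.δ} := by
    intro U hU
    show dist1 ((pre U c)⁻¹ * loopHol U c i * pre U c) < ℰ.δ
    have hconj := GaugeGroup.dist1_conj (loopHol U c i) (pre U c)⁻¹
    rw [inv_inv] at hconj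
    rw [hconj]
    exact hU i
  calc fieldMeasure P j G {U : GaugeField P j G | Small ℰ U c}
      ≤ fieldMeasure P j G ((fun U : GaugeField P j G => (pre U c)⁻¹ * loopHol U c i * pre U c) ⁻¹' {g : G | dist1 g < ℰ.δ}) :=
        measure_mono hsub
    _ = (fieldMeasure P j G).map (fun U : GaugeField P j G => (pre U c)⁻¹ * loopHol U c i * pre U c) {g : G | dist1 g < ℰ.δ} :=
        (Measure.map_apply (measurable_conj_loopHol c i) hball).symm
    _ = HaarData.haar {g : G | dist1 g < ℰ.δ} := by rw [map_conjLoopHol_eq_haar hj c hi]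

/-- **`dU(guard) ≤ #PBond(j+1) · Haar{dist1 < δ}`** (union bound over the coarse bonds). [cite: Balaban1987RG1, (0.4) p.253 (bookkeeping)] -/
theorem measure_guard_le (hj : j + 1 ≤ P.m + P.K) (hd : 2 ≤ P.d) :
    fieldMeasure P j G {U : GaugeField P j G | ∃ c : PBond P (j + 1), Small ℰ U c} ≤
      Fintype.card (PBond P (j + 1)) * HaarData.haar {g : G | dist1 g < ℰ.δ} := by
  rw [Set.setOf_exists]
  calc fieldMeasure P j G (⋃ c : PBond P (j + 1), {U : GaugeField P j G | Small ℰ U c})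
      ≤ ∑ c : PBond P (j + 1), fieldMeasure P j G {U : GaugeField P j G | Small ℰ U c} := measure_iUnion_fintype_le _ _
    _ ≤ ∑ _c : PBond P (j + 1), HaarData.haar {g : G | dist1 g < ℰ.δ} := Finset.sum_le_sum fun c _ => measure_small_le_haar_ball ℰ hj hd c
    _ = Fintype.card (PBond P (j + 1)) * HaarData.haar {g : G | dist1 g < ℰ.δ} := by
        rw [Finset.sum_const, Finset.card_univ, nsmul_eq_mul]

/-- **THE TYPED E6′ DEFECT IN ONE LINE**: `|Ū_*(dU)(A) − dV(A)| ≤ #PBond(j+1) · Haar{dist1 < δ}` for every measurable `A`, every measurable small-loop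
average, `d ≥ 2`, standing range. [cite: Balaban1987RG1, (0.4) p.253 (bookkeeping; E6′ itself NOT IN PRINT)] -/
theorem abs_map_avgFun_real_sub_le_card_mul (hj : j + 1 ≤ P.m + P.K) (hd : 2 ≤ P.d) (hE : ∀ n, Measurable fun W : Fin (n + 1) → G => ℰ.E W)
    {A : Set (GaugeField P (j + 1) G)} (hA : MeasurableSet A) :
    |((fieldMeasure P j G).map (avgFun ℰ)).real A - (fieldMeasure P (j + 1) G).real A| ≤
      Fintype.card (PBond P (j + 1)) * (HaarData.haar : Measure G).real {g : G | dist1 g < ℰ.δ} := by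
  refine (abs_map_avgFun_real_sub_le ℰ hj hE hA).trans ?_
  have h := measure_guard_le ℰ hj hd (G := G)
  have hne : (Fintype.card (PBond P (j + 1)) : ENNReal) * HaarData.haar {g : G | dist1 g < ℰ.δ} ≠ ⊤ :=
    ENNReal.mul_ne_top (ENNReal.natCast_ne_top _) (measure_ne_top _ _)
  have := ENNReal.toReal_mono hne h
  rwa [ENNReal.toReal_mul, ENNReal.toReal_natCast] at this

end GuardSize

/-! ## §4. At the [B10] slot's averaging `avOfPrint N S j` on `SU(N)` -/

section Slot

open Literature.MathematicalPhysics.QuantumFieldTheory.Balaban1985CMP102.Setting (Scales)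
open Literature.MathematicalPhysics.QuantumFieldTheory.Balaban1983to89.B10RunsOfRecord (avOfPrint TOfPrint)
open Literature.MathematicalPhysics.QuantumFieldTheory.Balaban1983to89.B10Eq2HaarCompatibility
open Literature.MathematicalPhysics.QuantumFieldTheory.Balaban1983to89.B10Eq2DensityTower (blockAvgStd blockAvgStd_avg_of_le)
open Literature.MathematicalPhysics.QuantumFieldTheory.Balaban1983to89.ExpMeanLog (expMeanLogSU expMeanLogSU_δ measurable_expMeanLogSU_E)
open Literature.MathematicalPhysics.QuantumFieldTheory.Balaban1983to89.Node00 (SU TFamily₃)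
open Literature.MathematicalPhysics.QuantumFieldTheory.Balaban1983to89.B12ContinuousTransportInvariance (isOpenPosMeasure_fieldMeasure_SU)
open Summit.QuantumFields.BalabanUV.T4Continuum.SubstrateBlockAvgContinuity (continuous_loopHol continuous_dist1_SU)
open Summit.QuantumFields.BalabanUV.T4Continuum.SubstrateBackgroundDriven (small_one_cfg)

variable (N : ℕ) [NeZero N] {L : ℕ}

/-- In the standing range print's averaging of record IS the typed (0.4) block averaging with the printed exp-mean-log on `SU(N)`.
[cite: Balaban1987RG1, (0.4) p.253; Balaban1985UV3, (2) p.256 (bookkeeping)] -/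
theorem avOfPrint_avg_of_le (S : Scales L) {j : ℕ} (hj : j + 1 ≤ S.P.m + S.P.K) :
    (avOfPrint N S j).avg = avgFun (expMeanLogSU : LoopAverage (SU N)) := by
  show (blockAvgStd S.P (SU N) expMeanLogSU j).avg = _
  rw [blockAvgStd_avg_of_le _ hj]

/-- **THE TYPED E6′ DEFECT AT THE SLOT'S AVERAGING IS AT MOST `dU(guard)`**: `|(avOfPrint)_*(dU)(A) − dV(A)| ≤ dU(guard)`, every `N`, every measurable
`A` (standing range; beyond it the left side is `0`, p434996 `map_avOfPrint_eq_of_not_le`).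
[cite: Balaban1987RG1, (0.4) p.253; Balaban1985UV3, (2) p.256 (bookkeeping; E6′ NOT IN PRINT)] -/
theorem abs_map_avOfPrint_real_sub_le (S : Scales L) {j : ℕ} (hj : j + 1 ≤ S.P.m + S.P.K) {A : Set (GaugeField S.P (j + 1) (SU N))}
    (hA : MeasurableSet A) :
    |((fieldMeasure S.P j (SU N)).map (avOfPrint N S j).avg).real A - (fieldMeasure S.P (j + 1) (SU N)).real A| ≤
      (fieldMeasure S.P j (SU N)).real
        {U : GaugeField S.P j (SU N) | ∃ c : PBond S.P (j + 1), Small (expMeanLogSU : LoopAverage (SU N)) U c} := by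
  rw [avOfPrint_avg_of_le N S hj]
  exact abs_map_avgFun_real_sub_le _ hj measurable_expMeanLogSU_E hA

/-- **E6′ AT THE SLOT IS A STATEMENT ABOUT THE GUARD ALONE**: `(avOfPrint)_*(dU) = dV ⟺ (dU↾guard)∘(avgFun expMeanLogSU)⁻¹ = (dU↾guard)∘axial⁻¹`
(standing range, every `N`). [cite: Balaban1987RG1, (0.4) p.253; Balaban1985UV3, (2) p.256 (bookkeeping; E6′ NOT IN PRINT)] -/
theorem map_avOfPrint_eq_iff_restrict_guard (S : Scales L) {j : ℕ} (hj : j + 1 ≤ S.P.m + S.P.K) :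
    (fieldMeasure S.P j (SU N)).map (avOfPrint N S j).avg = fieldMeasure S.P (j + 1) (SU N) ↔
      ((fieldMeasure S.P j (SU N)).restrict
          {U : GaugeField S.P j (SU N) | ∃ c : PBond S.P (j + 1), Small (expMeanLogSU : LoopAverage (SU N)) U c}).map
          (avgFun (expMeanLogSU : LoopAverage (SU N))) =
        ((fieldMeasure S.P j (SU N)).restrict
          {U : GaugeField S.P j (SU N) | ∃ c : PBond S.P (j + 1), Small (expMeanLogSU : LoopAverage (SU N)) U c}).map axialAvg := by
  rw [avOfPrint_avg_of_le N S hj]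
  exact map_avgFun_eq_iff_restrict_guard _ hj measurable_expMeanLogSU_E

/-- **THE SIZE OF THE SLOT'S GUARD**: `dU(guard) ≤ #PBond(j+1) · Haar_{SU(N)}{W | ‖W − 1‖ < min(1∕3, π∕N)}` (the radius of the printed exp-mean-log's
domain, `expMeanLogSU_δ`). [cite: Balaban1987RG1, (0.4) p.253 (bookkeeping)] -/
theorem measure_guard_avOfPrint_le (S : Scales L) {j : ℕ} (hj : j + 1 ≤ S.P.m + S.P.K) :
    fieldMeasure S.P j (SU N) {U : GaugeField S.P j (SU N) | ∃ c : PBond S.P (j + 1), Small (expMeanLogSU : LoopAverage (SU N)) U c} ≤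
      Fintype.card (PBond S.P (j + 1)) * (HaarData.haar : Measure (SU N)) {g : SU N | dist1 g < min (1 / 3) (Real.pi / N)} := by
  have h := measure_guard_le (expMeanLogSU : LoopAverage (SU N)) hj (show 2 ≤ S.P.d by show 2 ≤ 3; norm_num)
  rwa [expMeanLogSU_δ, Fintype.card_fin] at h

/-- **THE TYPED E6′ DEFECT AT THE SLOT IN ONE LINE**: `|(avOfPrint)_*(dU)(A) − dV(A)| ≤ #PBond(j+1) · Haar_{SU(N)}{‖W − 1‖ < min(1∕3, π∕N)}`, standing
range, every `N`, every measurable `A`. [cite: Balaban1987RG1, (0.4) p.253; Balaban1985UV3, (2) p.256 (bookkeeping; E6′ NOT IN PRINT)] -/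
theorem abs_map_avOfPrint_real_sub_le_card_mul (S : Scales L) {j : ℕ} (hj : j + 1 ≤ S.P.m + S.P.K)
    {A : Set (GaugeField S.P (j + 1) (SU N))} (hA : MeasurableSet A) :
    |((fieldMeasure S.P j (SU N)).map (avOfPrint N S j).avg).real A - (fieldMeasure S.P (j + 1) (SU N)).real A| ≤
      Fintype.card (PBond S.P (j + 1)) * (HaarData.haar : Measure (SU N)).real {g : SU N | dist1 g < min (1 / 3) (Real.pi / N)} := by
  have h := abs_map_avgFun_real_sub_le_card_mul (expMeanLogSU : LoopAverage (SU N)) hj (show 2 ≤ S.P.d by show 2 ≤ 3; norm_num) measurable_expMeanLogSU_E hA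
  rwa [← avOfPrint_avg_of_le N S hj, expMeanLogSU_δ, Fintype.card_fin] at h

/-- The slot's small-field domain at a coarse bond is OPEN (loop variables and `‖· − 1‖` are continuous). [folklore] -/
theorem isOpen_small (S : Scales L) (j : ℕ) (c : PBond S.P (j + 1)) :
    IsOpen {U : GaugeField S.P j (SU N) | Small (expMeanLogSU : LoopAverage (SU N)) U c} := by
  simp only [BlockAveraging.Small, Set.setOf_forall]
  exact isOpen_iInter_of_finite fun i => isOpen_lt ((continuous_dist1_SU (n := Fin N)).comp (continuous_loopHol c i)) continuous_const

/-- **THE GUARD IS NOT `dU`-NULL**: `0 < dU{Small · c}` (the flat configuration lies in the open small-field domain; product Haar on `SU(N)` charges open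
sets, `isOpenPosMeasure_fieldMeasure_SU`) — so THIS FILE DOES NOT PROVE the typed E6′: its defect bound is positive. [cite: Balaban1987RG1, (0.4) p.253 (bookkeeping)] -/
theorem measure_small_pos (S : Scales L) (j : ℕ) (c : PBond S.P (j + 1)) :
    0 < fieldMeasure S.P j (SU N) {U : GaugeField S.P j (SU N) | Small (expMeanLogSU : LoopAverage (SU N)) U c} :=
  pos_iff_ne_zero.2 ((isOpenPosMeasure_fieldMeasure_SU N S.P j).open_pos _ (isOpen_small N S j c) ⟨1, small_one_cfg _ c⟩)

/-- … hence `0 < dU(guard)` at every level. [cite: Balaban1987RG1, (0.4) p.253 (bookkeeping)] -/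
theorem measure_guard_pos (S : Scales L) (j : ℕ) :
    0 < fieldMeasure S.P j (SU N) {U : GaugeField S.P j (SU N) | ∃ c : PBond S.P (j + 1), Small (expMeanLogSU : LoopAverage (SU N)) U c} :=
  (measure_small_pos N S j ⟨default, ⟨0, by have := S.P.hd; omega⟩⟩).trans_le (measure_mono fun U hU => ⟨_, hU⟩)

variable (L) in
/-- **THE T-LETTER OF THE SLOT**: for EVERY transformation family `𝔗 : Node00.TFamily₃ N L` (versions of (10) along `avOfPrint`; in particular print's own
`TOfPrint N`), every member, in-range level and measurable `A`: `|∫_A (𝔗 S j).T 1 dV − dV(A)| ≤ #PBond(j+1) · Haar_{SU(N)}{‖W − 1‖ < min(1∕3, π∕N)}`.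
[cite: Balaban1985Averaging, (10) p.19; Balaban1987RG1, (0.4) p.253 (bookkeeping; «T1 = 1» NOT IN PRINT)] -/
theorem abs_setIntegral_TFamily_one_sub_le_card_mul (𝔗 : TFamily₃ N L) (S : Scales L) {j : ℕ} (hj : j + 1 ≤ S.P.m + S.P.K)
    {A : Set (GaugeField S.P (j + 1) (SU N))} (hA : MeasurableSet A) :
    |∫ V in A, (𝔗 S j).T 1 V ∂(fieldMeasure S.P (j + 1) (SU N)) - (fieldMeasure S.P (j + 1) (SU N)).real A| ≤
      Fintype.card (PBond S.P (j + 1)) * (HaarData.haar : Measure (SU N)).real {g : SU N | dist1 g < min (1 / 3) (Real.pi / N)} := by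
  rw [setIntegral_T_one (𝔗 S j) (measurable_avOfPrint N S j) hA, ← Measure.map_apply (measurable_avOfPrint N S j) hA]
  exact abs_map_avOfPrint_real_sub_le_card_mul N S hj hA

variable (L) in
/-- **«T1 =ᵐ 1» AT THE SLOT IS A STATEMENT ABOUT THE GUARD ALONE**: for EVERY transformation family `𝔗`, `(𝔗 S j).T 1 =ᵐ 1 ⟺` the restricted identity on
the guard (p434996 `map_avOfPrint_eq_iff`). [cite: Balaban1985Averaging, (10) p.19; Balaban1987RG1, (0.4) p.253 (bookkeeping; «T1 = 1» NOT IN PRINT)] -/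
theorem TFamily_one_ae_eq_one_iff_restrict_guard (𝔗 : TFamily₃ N L) (S : Scales L) {j : ℕ} (hj : j + 1 ≤ S.P.m + S.P.K) :
    (𝔗 S j).T 1 =ᵐ[fieldMeasure S.P (j + 1) (SU N)] 1 ↔
      ((fieldMeasure S.P j (SU N)).restrict
          {U : GaugeField S.P j (SU N) | ∃ c : PBond S.P (j + 1), Small (expMeanLogSU : LoopAverage (SU N)) U c}).map
          (avgFun (expMeanLogSU : LoopAverage (SU N))) =
        ((fieldMeasure S.P j (SU N)).restrict
          {U : GaugeField S.P j (SU N) | ∃ c : PBond S.P (j + 1), Small (expMeanLogSU : LoopAverage (SU N)) U c}).map axialAvg := by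
  rw [← map_avOfPrint_eq_iff N S j 𝔗]
  exact map_avOfPrint_eq_iff_restrict_guard N S hj

end Slot

end Summit.QuantumFields.YangMills.BalabanUVNodes.N08HaarCompatibilityGuard

end
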